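import Literature.NumberTheory.EllipticCurves.H1UnramifiedFinite
import Literature.NumberTheory.EllipticCurves.GaloisActionProofs
import Literature.NumberTheory.EllipticCurves.SwanConductorTorsionProofs
import Literature.NumberTheory.GaloisRepresentations.ArtinRestriction
import Literature.NumberTheory.GaloisRepresentations.RamificationFiltration
import HarnessLib

/-!
# The `n`-division field `K(E[n])` and the field `K(x(E[n]))` of `x`-coordinates

Definitions file in topic `NumberTheory/EllipticCurves`, landed by the seat of bsd.S15
(`Literature.NumberTheory.EllipticCurves.conductorNorm_eq_artinConductorNat_of_isElliptic`) to name
the two finite Galois subextensions of `K̄/K` through which the computation of the wild conductor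
of an elliptic curve runs (Silverman, *Advanced Topics in the Arithmetic of Elliptic Curves*,
§IV.10: *"Let `L = K(E[ℓ])` … `δ(E/K) = Σ_{i ≥ 1} (gᵢ/g₀) dim(E[ℓ]/E[ℓ]^{Gᵢ})`"*, PDF p. 358;
and the field of `x`-coordinates `L^{[-1]}` of `ThreeTorsionCentralInvolutionSwanProofs`):

* `WeierstrassCurve.divisionField W n = K(E[n]) ⊆ K̄` — the fixed field of the kernel
  `Γ_{K(E[n])} = fixingSubgroupOfModule K E[n]` of the action of `Γ_K` on `E[n] = geomTorsion W n`
  (the tree's `torsionFixing`); for `E` elliptic and `n ≠ 0` it is finite Galois over `K`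
  (the kernel is open and normal, Mathlib `InfiniteGalois.isOpen_iff_finite`,
  `InfiniteGalois.normal_iff_isGalois`), its fixing group is the kernel
  (`fixingSubgroup_divisionField`), so that **`σ|_{K(E[n])} = 1 ↔ σ` fixes `E[n]` pointwise**
  (`absRestrictNormalHom_divisionField_eq_one_iff`), and it contains the coordinates of the
  `n`-torsion points (`mem_divisionField_of_eq_some`);
* `WeierstrassCurve.xFixingSubgroup W n ≤ Γ_K` — the elements fixing the `x`-coordinate of
  every non-zero point of `E[n]`, an open normal subgroup containing `Γ_{K(E[n])}`;
* `WeierstrassCurve.xDivisionField W n = K(x(E[n])) ⊆ K(E[n])` — its fixed field, finite Galois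
  over `K`, with **`σ|_{K(x(E[n]))} = 1 ↔ σ` fixes every `x(T)`**
  (`absRestrictNormalHom_xDivisionField_eq_one_iff`) and containing the `x(T)`
  (`mem_xDivisionField_of_eq_some`).

These are exactly the hypotheses `hL`, `hLf`, `hle`, `hEx`/`hkerE` of
`ThreeTorsionCentralInvolutionSwanProofs` (`swanConductorAt_torsion_eq_two_mul_herbrandPhi_quotient`,
`absRestrictNormalHom_eq_one_iff_of_forall_x`), where for `n = 3` and a prime above `2` the field
`K(x(E[3]))` is the fixed field of the central involution `[-1]`.

## References

* J. H. Silverman, *Advanced Topics in the Arithmetic of Elliptic Curves*, GTM 151 (1994), §IV.10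
  (Definition of `δ(E/K)` with `L = K(E[ℓ])`, PDF p. 358). [SilvermanATAEC1994]
* J. H. Silverman, *The Arithmetic of Elliptic Curves*, 2nd ed. (2009), III.2.3, VIII.§1
  (the action of `Γ_K` on `E(K̄)` and on `E[m]`). [SilvermanAEC2009]
* J.-P. Serre, *Abelian ℓ-adic representations and elliptic curves* (1968), IV.1.1–1.2
  (`K(E[ℓ])`, the image of `Γ_K` in `Aut(E[ℓ])`). [SerreAbelianLadic1968]

## Design

`divisionField` and `xDivisionField` are `IntermediateField.fixedField`s of subgroups of
`Γ_K = absoluteGaloisGroup K` (Mathlib's infinite Galois theory), not `IntermediateField.adjoin`s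
of coordinate sets, so that the kernel characterisations are immediate; membership of the
coordinates follows from `IntermediateField.mem_fixedField_iff`.  Finite-dimensionality and the
Galois property are instances under `[W.IsElliptic] [NeZero n]` (and `char K = 0`, the setting of
the tree's `fixingSubgroup_fixedField_of_isOpen`, so that `K̄/K` is Galois).  Namespace `WeierstrassCurve`; `noncomputable section`.  Axioms: `propext`,
`Classical.choice`, `Quot.sound`.
-/

noncomputable section

open scoped Classical
open Field Literature.NumberTheory.EllipticCurves Literature.NumberTheory.GaloisRepresentations

universe u

namespace WeierstrassCurve

variable {K : Type u} [Field K] (W : WeierstrassCurve K) (n : ℕ)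

/-! ### The `n`-division field -/

/-- **The `n`-division field `K(E[n]) ⊆ K̄`**: the fixed field of the kernel
`Γ_{K(E[n])} = {σ ∈ Γ_K : σT = T for all T ∈ E[n]}` (`fixingSubgroupOfModule K E[n]`, the
tree's `torsionFixing`) of the action of `Γ_K` on the geometric `n`-torsion `E[n] = E(K̄)[n]`.
Silverman, *ATAEC* §IV.10 (`L = K(E[ℓ])`); *AEC* VIII.§1.
[cite: SilvermanATAEC1994, §IV.10 Definition of δ(E/K) (PDF p. 358)] -/
def divisionField : IntermediateField K (AlgebraicClosure K) :=
  IntermediateField.fixedField (fixingSubgroupOfModule K (geomTorsion W n))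

/-- Unfolding: `K(E[n])` is the fixed field of `Γ_{K(E[n])}`. [folklore] -/
theorem divisionField_def :
    W.divisionField n = IntermediateField.fixedField (fixingSubgroupOfModule K (geomTorsion W n)) :=
  rfl

/-- `σ ∈ Γ_{K(E[n])}` iff `σ` fixes `E[n]` pointwise. [folklore] -/
theorem mem_fixingSubgroupOfModule_geomTorsion_iff {σ : absoluteGaloisGroup K} :
    σ ∈ fixingSubgroupOfModule K (geomTorsion W n) ↔ ∀ T : geomTorsion W n, σ • T = T := by
  simp only [fixingSubgroupOfModule, Subgroup.mem_iInf, MulAction.mem_stabilizer_iff]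

/-- `Γ_{K(E[n])}` is normal in `Γ_K` (the kernel of the action). [folklore] -/
theorem fixingSubgroupOfModule_geomTorsion_normal :
    (fixingSubgroupOfModule K (geomTorsion W n)).Normal := by
  refine ⟨fun ρ hρ g ↦ (W.mem_fixingSubgroupOfModule_geomTorsion_iff n).mpr fun P ↦ ?_⟩
  rw [mul_smul, mul_smul, (W.mem_fixingSubgroupOfModule_geomTorsion_iff n).mp hρ, smul_inv_smul]

/-- For `E` elliptic and `n ≠ 0`, `Γ_{K(E[n])}` is open (`E[n]` is finite with continuous
action: a finite intersection of open stabilisers). [folklore] -/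
theorem isOpen_fixingSubgroupOfModule_geomTorsion [W.IsElliptic] [NeZero n] :
    IsOpen (fixingSubgroupOfModule K (geomTorsion W n) : Set (absoluteGaloisGroup K)) := by
  haveI : Finite (geomTorsion W n) := W.finite_geomTorsion_nat (NeZero.ne n)
  haveI := continuousSMul_geomTorsion W (isOpen_stabilizer_point_holds W) n
  exact isOpen_fixingSubgroupOfModule

/-- An element of `K̄` fixed by `Γ_{K(E[n])}` lies in `K(E[n])` (definition of the fixed field).
[folklore] -/
theorem mem_divisionField_iff {x : AlgebraicClosure K} :
    x ∈ W.divisionField n ↔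
      ∀ σ : absoluteGaloisGroup K, (∀ T : geomTorsion W n, σ • T = T) → σ • x = x := by
  rw [divisionField, IntermediateField.mem_fixedField_iff]
  constructor
  · intro h σ hσ
    exact h σ ((W.mem_fixingSubgroupOfModule_geomTorsion_iff n).mpr hσ)
  · intro h σ hσ
    exact h σ ((W.mem_fixingSubgroupOfModule_geomTorsion_iff n).mp hσ)

/-- **The coordinates of the `n`-torsion points lie in `K(E[n])`**: if `T = (x, y) ∈ E[n]` then
`x, y ∈ K(E[n])` (an element fixing `T` fixes its coordinates).  *AEC* VIII.§1.
[cite: SilvermanAEC2009, VIII.§1 (action of G_{K̄/K} on E[m])] -/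
theorem mem_divisionField_of_eq_some {T : geomTorsion W n} {x y : AlgebraicClosure K}
    {h : (W.baseChange (AlgebraicClosure K)).toAffine.Nonsingular x y}
    (hT : (T : geomPoints W) = Affine.Point.some x y h) :
    x ∈ W.divisionField n ∧ y ∈ W.divisionField n := by
  have key : ∀ σ : absoluteGaloisGroup K, (∀ T : geomTorsion W n, σ • T = T) →
      σ • x = x ∧ σ • y = y := by
    intro σ hσ
    have hval : σ • (T : geomPoints W) = (T : geomPoints W) :=
      congrArg (fun P : geomTorsion W n => (P : geomPoints W)) (hσ T)
    rw [hT] at hval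
    have hmap : Affine.Point.map ((show AlgebraicClosure K ≃ₐ[K] AlgebraicClosure K from σ) :
        AlgebraicClosure K →ₐ[K] AlgebraicClosure K) (Affine.Point.some x y h) =
        Affine.Point.some x y h := hval
    rw [Affine.Point.map_some] at hmap
    simp only [Affine.Point.some.injEq] at hmap
    exact ⟨hmap.1, hmap.2⟩
  exact ⟨(W.mem_divisionField_iff n).mpr fun σ hσ => (key σ hσ).1,
    (W.mem_divisionField_iff n).mpr fun σ hσ => (key σ hσ).2⟩

section Galois

variable [CharZero K]

/-- **The fixing group of `K(E[n])` is `Γ_{K(E[n])}`** (`E` elliptic, `n ≠ 0`, `char K = 0`):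
`Γ_{K(E[n])}` is open, hence closed, and the Galois correspondence for closed subgroups of
`Γ_K` applies (`fixingSubgroup_fixedField_of_isOpen`, Mathlib `InfiniteGalois.fixingSubgroup_fixedField`).
[folklore] -/
theorem fixingSubgroup_divisionField [W.IsElliptic] [NeZero n] :
    ((W.divisionField n).fixingSubgroup : Subgroup (absoluteGaloisGroup K)) =
      fixingSubgroupOfModule K (geomTorsion W n) :=
  fixingSubgroup_fixedField_of_isOpen _ (W.isOpen_fixingSubgroupOfModule_geomTorsion n)

/-- `K(E[n])/K` is finite (`E` elliptic, `n ≠ 0`): its fixing group is open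
(`finiteDimensional_fixedField_of_isOpen`). [cite: SilvermanAEC2009, VIII.§1] -/
instance finiteDimensional_divisionField [W.IsElliptic] [NeZero n] :
    FiniteDimensional K (W.divisionField n) :=
  finiteDimensional_fixedField_of_isOpen _ (W.isOpen_fixingSubgroupOfModule_geomTorsion n)

/-- `K(E[n])/K` is Galois (`E` elliptic, `n ≠ 0`): its fixing group is the normal subgroup
`Γ_{K(E[n])}` (Mathlib `InfiniteGalois.normal_iff_isGalois`). [cite: SilvermanAEC2009, VIII.§1] -/
instance isGalois_divisionField [W.IsElliptic] [NeZero n] : IsGalois K (W.divisionField n) := by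
  haveI : IsGalois K (AlgebraicClosure K) := {}
  rw [← InfiniteGalois.normal_iff_isGalois, W.fixingSubgroup_divisionField n]
  exact W.fixingSubgroupOfModule_geomTorsion_normal n

/-- **`σ|_{K(E[n])} = 1 ↔ σ` fixes `E[n]` pointwise** (`E` elliptic, `n ≠ 0`, `char K = 0`):
the kernel of the restriction `Γ_K → Gal(K(E[n])/K)` is the fixing group `Γ_{K(E[n])}`.  These
are the hypotheses `hL`, `hLf` of `ThreeTorsionCentralInvolutionSwanProofs`.
[cite: SilvermanATAEC1994, §IV.10 (L = K(E[ℓ]), PDF p. 358)] -/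
theorem absRestrictNormalHom_divisionField_eq_one_iff [W.IsElliptic] [NeZero n]
    (σ : absoluteGaloisGroup K) :
    absRestrictNormalHom (W.divisionField n) σ = 1 ↔ ∀ T : geomTorsion W n, σ • T = T := by
  have h1 : absRestrictNormalHom (W.divisionField n) σ = 1 ↔
      ∀ x : W.divisionField n, σ • (x : AlgebraicClosure K) = x := by
    change AlgEquiv.restrictNormalHom _ (absoluteGaloisGroup.toAlgEquiv K σ) = 1 ↔ _
    rw [AlgEquiv.ext_iff]
    constructor
    · intro h x
      have := congrArg (fun y : W.divisionField n => (y : AlgebraicClosure K)) (h x)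
      rw [AlgEquiv.restrictNormalHom_apply, AlgEquiv.one_apply] at this
      exact this
    · intro h x
      apply Subtype.ext
      rw [AlgEquiv.restrictNormalHom_apply, AlgEquiv.one_apply]
      exact h x
  rw [h1, ← mem_fixingSubgroup_iff_forall_smul]
  exact (SetLike.ext_iff.mp (W.fixingSubgroup_divisionField n) σ).trans
    (W.mem_fixingSubgroupOfModule_geomTorsion_iff n)

end Galois

/-! ### The field of `x`-coordinates -/

/-- **The subgroup of `Γ_K` fixing the `x`-coordinates of the non-zero `n`-torsion points.**
[cite: SilvermanAEC2009, III.2.3 and VIII.§1] -/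
def xFixingSubgroup : Subgroup (absoluteGaloisGroup K) where
  carrier := {σ | ∀ (T : geomTorsion W n) (x y : AlgebraicClosure K)
    (h : (W.baseChange (AlgebraicClosure K)).toAffine.Nonsingular x y),
    (T : geomPoints W) = Affine.Point.some x y h → σ • x = x}
  one_mem' := fun _ _ _ _ _ => one_smul _ _
  mul_mem' := fun {σ τ} hσ hτ T x y h hT => by
    rw [mul_smul, hτ T x y h hT, hσ T x y h hT]
  inv_mem' := fun {σ} hσ T x y h hT => by
    rw [inv_smul_eq_iff, hσ T x y h hT]

/-- Membership in `xFixingSubgroup`. [folklore] -/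
theorem mem_xFixingSubgroup_iff {σ : absoluteGaloisGroup K} :
    σ ∈ W.xFixingSubgroup n ↔ ∀ (T : geomTorsion W n) (x y : AlgebraicClosure K)
      (h : (W.baseChange (AlgebraicClosure K)).toAffine.Nonsingular x y),
      (T : geomPoints W) = Affine.Point.some x y h → σ • x = x :=
  Iff.rfl

/-- `Γ_{K(E[n])} ≤ xFixingSubgroup`: an element fixing `T` fixes `x(T)`. [folklore] -/
theorem fixingSubgroupOfModule_le_xFixingSubgroup :
    fixingSubgroupOfModule K (geomTorsion W n) ≤ W.xFixingSubgroup n := by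
  intro σ hσ T x y h hT
  have hval : σ • (T : geomPoints W) = (T : geomPoints W) :=
    congrArg (fun P : geomTorsion W n => (P : geomPoints W))
      ((W.mem_fixingSubgroupOfModule_geomTorsion_iff n).mp hσ T)
  rw [hT] at hval
  have hmap : Affine.Point.map ((show AlgebraicClosure K ≃ₐ[K] AlgebraicClosure K from σ) :
      AlgebraicClosure K →ₐ[K] AlgebraicClosure K) (Affine.Point.some x y h) =
      Affine.Point.some x y h := hval
  rw [Affine.Point.map_some] at hmap
  simp only [Affine.Point.some.injEq] at hmap
  exact hmap.1

/-- `xFixingSubgroup` is normal in `Γ_K`: `x(gT) = g x(T)` for `g ∈ Γ_K`, `T ∈ E[n]`. [folklore] -/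
theorem xFixingSubgroup_normal : (W.xFixingSubgroup n).Normal := by
  refine ⟨fun ρ hρ g T x y h hT ↦ ?_⟩
  -- the point `g⁻¹ T = (g⁻¹ x, g⁻¹ y)`
  have hval : ((g⁻¹ • T : geomTorsion W n) : geomPoints W) =
      Affine.Point.map ((show AlgebraicClosure K ≃ₐ[K] AlgebraicClosure K from g⁻¹) :
        AlgebraicClosure K →ₐ[K] AlgebraicClosure K) (Affine.Point.some x y h) := by
    rw [← hT]; rfl
  rw [Affine.Point.map_some] at hval
  have hx : ρ • g⁻¹ • x = g⁻¹ • x := hρ (g⁻¹ • T) _ _ _ hval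
  rw [mul_smul, mul_smul, hx, smul_inv_smul]

/-- `xFixingSubgroup` is open for `E` elliptic and `n ≠ 0` (it contains the open subgroup
`Γ_{K(E[n])}`). [folklore] -/
theorem isOpen_xFixingSubgroup [W.IsElliptic] [NeZero n] :
    IsOpen (W.xFixingSubgroup n : Set (absoluteGaloisGroup K)) :=
  Subgroup.isOpen_mono (W.fixingSubgroupOfModule_le_xFixingSubgroup n)
    (W.isOpen_fixingSubgroupOfModule_geomTorsion n)

/-- **The field `K(x(E[n])) ⊆ K̄` of `x`-coordinates of the `n`-torsion**: the fixed field of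
`xFixingSubgroup`.  For `n = 3` at a prime above `2` this is the fixed field `L^{[-1]}` of the
central involution of `L = K(E[3])` (`ThreeTorsionCentralInvolutionSwanProofs`).
[cite: SilvermanAEC2009, III.2.3 and VIII.§1] -/
def xDivisionField : IntermediateField K (AlgebraicClosure K) :=
  IntermediateField.fixedField (W.xFixingSubgroup n)

/-- Unfolding: `K(x(E[n]))` is the fixed field of `xFixingSubgroup`. [folklore] -/
theorem xDivisionField_def :
    W.xDivisionField n = IntermediateField.fixedField (W.xFixingSubgroup n) :=
  rfl

/-- `K(x(E[n])) ≤ K(E[n])` (the fixed field of a larger subgroup is smaller).  Hypothesis `hle` of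
`ThreeTorsionCentralInvolutionSwanProofs`. [folklore] -/
theorem xDivisionField_le_divisionField : W.xDivisionField n ≤ W.divisionField n :=
  IntermediateField.fixedField_le (W.fixingSubgroupOfModule_le_xFixingSubgroup n)

/-- **The `x`-coordinates of the `n`-torsion points lie in `K(x(E[n]))`.**
[cite: SilvermanAEC2009, III.2.3 and VIII.§1] -/
theorem mem_xDivisionField_of_eq_some {T : geomTorsion W n} {x y : AlgebraicClosure K}
    {h : (W.baseChange (AlgebraicClosure K)).toAffine.Nonsingular x y}
    (hT : (T : geomPoints W) = Affine.Point.some x y h) : x ∈ W.xDivisionField n := by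
  rw [xDivisionField, IntermediateField.mem_fixedField_iff]
  intro σ hσ
  exact hσ T x y h hT

section GaloisX

variable [CharZero K]

/-- The fixing group of `K(x(E[n]))` is `xFixingSubgroup` (`E` elliptic, `n ≠ 0`, `char K = 0`).
[folklore] -/
theorem fixingSubgroup_xDivisionField [W.IsElliptic] [NeZero n] :
    ((W.xDivisionField n).fixingSubgroup : Subgroup (absoluteGaloisGroup K)) =
      W.xFixingSubgroup n :=
  fixingSubgroup_fixedField_of_isOpen _ (W.isOpen_xFixingSubgroup n)

/-- `K(x(E[n]))/K` is finite (`E` elliptic, `n ≠ 0`). [folklore] -/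
instance finiteDimensional_xDivisionField [W.IsElliptic] [NeZero n] :
    FiniteDimensional K (W.xDivisionField n) :=
  finiteDimensional_fixedField_of_isOpen _ (W.isOpen_xFixingSubgroup n)

/-- `K(x(E[n]))/K` is Galois (`E` elliptic, `n ≠ 0`). [folklore] -/
instance isGalois_xDivisionField [W.IsElliptic] [NeZero n] : IsGalois K (W.xDivisionField n) := by
  haveI : IsGalois K (AlgebraicClosure K) := {}
  rw [← InfiniteGalois.normal_iff_isGalois, W.fixingSubgroup_xDivisionField n]
  exact W.xFixingSubgroup_normal n

/-- **`σ|_{K(x(E[n]))} = 1 ↔ σ` fixes the `x`-coordinate of every non-zero `n`-torsion point**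
(`E` elliptic, `n ≠ 0`, `char K = 0`).  Hypothesis `hEx` of
`absRestrictNormalHom_eq_one_iff_of_forall_x` (`ThreeTorsionCentralInvolutionSwanProofs`).
[cite: SilvermanAEC2009, III.2.3 and VIII.§1] -/
theorem absRestrictNormalHom_xDivisionField_eq_one_iff [W.IsElliptic] [NeZero n]
    (σ : absoluteGaloisGroup K) :
    absRestrictNormalHom (W.xDivisionField n) σ = 1 ↔
      ∀ (T : geomTorsion W n) (x y : AlgebraicClosure K)
        (h : (W.baseChange (AlgebraicClosure K)).toAffine.Nonsingular x y),
        (T : geomPoints W) = Affine.Point.some x y h → σ • x = x := by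
  have h1 : absRestrictNormalHom (W.xDivisionField n) σ = 1 ↔
      ∀ x : W.xDivisionField n, σ • (x : AlgebraicClosure K) = x := by
    change AlgEquiv.restrictNormalHom _ (absoluteGaloisGroup.toAlgEquiv K σ) = 1 ↔ _
    rw [AlgEquiv.ext_iff]
    constructor
    · intro h x
      have := congrArg (fun y : W.xDivisionField n => (y : AlgebraicClosure K)) (h x)
      rw [AlgEquiv.restrictNormalHom_apply, AlgEquiv.one_apply] at this
      exact this
    · intro h x
      apply Subtype.ext
      rw [AlgEquiv.restrictNormalHom_apply, AlgEquiv.one_apply]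
      exact h x
  rw [h1, ← mem_fixingSubgroup_iff_forall_smul]
  exact (SetLike.ext_iff.mp (W.fixingSubgroup_xDivisionField n) σ).trans
    (W.mem_xFixingSubgroup_iff n)

end GaloisX

end WeierstrassCurve

end
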